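import Summits.QuantumAdvantage.QuantumAdvantage.Theorems.CubicForrelationNearExactIsExactSixteenLevelEightPrep

/-!
# Crux `CubicForrelation.NearExactIsExact` (stmt-QuantumAdvantage-14043) — sign patterns that are QUADRATIC ALONG A FLAT:
  parametrised-flat bookkeeping and the relative alternating form (general `n`)

Certificate seat `b2b-cforr-cert` (gen 6).  HONEST FRAMING: infrastructure lemmas about Boolean functions on `𝔽₂ⁿ` restricted to a coset
`S = x₀ ⊕ V₀` of a `⊕`-closed `V₀` (input to the two-sided analysis of the boundary value `Φ = 31/32` on 16 bits, where the residual
`W_g/64 − 4(−1)^f` lives on a 14-, 13-, 12- or 11-flat that is NOT a coordinate cube) — NOT summit progress.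

* `fr_sum_peel`, `fr_sum3`, `fr_sum4` (with the landed `fl_pt_four`): a parametrised `(k+1)`-flat sum splits off its first direction; the parametrised 3- and 4-flat sums
  `Σ_ε F(x ⊕ ε·(a,b,c[,d]))` written out as `8` / `16` explicit terms.  `fr_mem_flatPt3/4`: flat points with base in `S` and directions in
  `V₀` stay in `S` (membership given by a predicate `P` with `P x → a ∈ V₀ → P (x ⊕ a)`).
* `fr_hsd`: if all parametrised 3-flat sign sums `Σ_ε (−1)^{h(x ⊕ ε·(a,b,c))}` (`x ∈ S`, `a,b,c ∈ V₀`) are `≡ 0 (mod 4)`, then the second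
  differences of `h` along `V₀` do not depend on the base point in `S`:  `h(x⊕p⊕q) = h(x) ⊕ h(x⊕p) ⊕ h(x⊕q) ⊕ B(p,q)` with
  `B(p,q) = h(x₀) ⊕ h(x₀⊕p) ⊕ h(x₀⊕q) ⊕ h(x₀⊕p⊕q)` ("`h` is quadratic along `S`").
* `fr_B_symm`, `fr_B_self`, `fr_B_add_left`: `B` is a symmetric alternating bi-additive form on `V₀`; `fr_gs`: symplectic Gram–Schmidt
  inside `V₀`; `fr_diff_outside`: pigeonhole inside `V₀` (two points of one fibre of a labelling differ by a vector outside a small set).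
The extraction of two orthogonal hyperbolic pairs and the radical bound are in `…FlatRadical.lean`.

References: F. J. MacWilliams, N. J. A. Sloane (1977) Ch. 15 §2 (symplectic forms over `𝔽₂`); C. Carlet (2021) §5.2.  Everything below is
proved from Mathlib and the tree; axioms are the standard three.
-/

set_option linter.dupNamespace false -- D-0017: single-problem summit ⇒ `QuantumAdvantage.QuantumAdvantage` by design

noncomputable section

namespace Summit.QuantumAdvantage.QuantumAdvantage.Theorems.CubicForrelation.NearExactIsExact

open Finset
open Literature.Computability.QuantumComplexity
open Literature.Computability.QuantumComplexity.BuzetChailloux (bxor zeroVec bxor_bxor_cancel_left bxor_zeroVec zeroVec_bxor bxor_comm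
  bxor_self)
open Summit.QuantumAdvantage.QuantumAdvantage.Theorems.CubicForrelation.ExactPairsMaioranaMcFarland (dv_bxor_right_comm)

variable {n : ℕ}

/-! ### Parametrised flat sums: peeling and explicit expansions -/

/-- **Peeling the first direction.** `Σ_{ε ∈ 𝔽₂^{k+1}} F(x ⊕ ε·(t,a)) = Σ_{ε ∈ 𝔽₂^k} F(x ⊕ ε·a) + Σ_{ε ∈ 𝔽₂^k} F((x ⊕ ε·a) ⊕ t)`.
[folklore] -/
theorem fr_sum_peel {k : ℕ} (F : (Fin n → Bool) → ℤ) (x t : Fin n → Bool) (a : Fin k → Fin n → Bool) :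
    ∑ ε : Fin (k + 1) → Bool, F (fun j => x j ^^ decide (Odd #(univ.filter fun i =>
        ε i && (Matrix.vecCons t a : Fin (k + 1) → Fin n → Bool) i j))) =
      ∑ ε : Fin k → Bool, F (fun j => x j ^^ decide (Odd #(univ.filter fun i => ε i && a i j))) +
      ∑ ε : Fin k → Bool, F (bxor (fun j => x j ^^ decide (Odd #(univ.filter fun i => ε i && a i j))) t) := by
  show ∑ ε : Fin (k + 1) → Bool, F (fun j => x j ^^ decide (Odd #(univ.filter fun i =>
        ε i && (Fin.cons t a : Fin (k + 1) → Fin n → Bool) i j))) = _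
  rw [tep_sum_split]
  congr 1
  · refine sum_congr rfl fun ε _ => ?_
    rw [erm_flatPt_cons]
    congr 1
    funext j
    simp
  · refine sum_congr rfl fun ε _ => ?_
    rw [erm_flatPt_cons]
    congr 1

/-- The point of a parametrised 3-flat (cons form) as an iterated `⊕`: `x ⊕ ε₂c ⊕ ε₁b ⊕ ε₀a`. [folklore] -/
theorem fr_pt3 (x a b c : Fin n → Bool) (e₀ e₁ e₂ : Bool) (t : Fin 0 → Bool) (ta : Fin 0 → Fin n → Bool) :
    (fun j => x j ^^ decide (Odd #(univ.filter fun i : Fin 3 =>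
      (Fin.cons e₀ (Fin.cons e₁ (Fin.cons e₂ t : Fin 1 → Bool) : Fin 2 → Bool) : Fin 3 → Bool) i &&
      (Fin.cons a (Fin.cons b (Fin.cons c ta : Fin 1 → Fin n → Bool) : Fin 2 → Fin n → Bool) : Fin 3 → Fin n → Bool) i j))) =
      bxor (bxor (bxor x (fun j => e₂ && c j)) (fun j => e₁ && b j)) (fun j => e₀ && a j) := by
  have h1 := erm_flatPt_cons x a (Fin.cons b (Fin.cons c ta : Fin 1 → Fin n → Bool) : Fin 2 → Fin n → Bool) e₀
    (Fin.cons e₁ (Fin.cons e₂ t : Fin 1 → Bool) : Fin 2 → Bool)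
  have h2 := erm_flatPt_cons x b (Fin.cons c ta : Fin 1 → Fin n → Bool) e₁ (Fin.cons e₂ t : Fin 1 → Bool)
  have h3 := erm_flatPt_cons x c ta e₂ t
  have h4 := tep_flatPt_nil x ta t
  rw [h1]
  funext j
  rw [congrFun h2 j, congrFun h3 j, congrFun h4 j]

/-- **The parametrised 3-flat sum, written out** (later directions innermost). [folklore] -/
theorem fr_sum3 (F : (Fin n → Bool) → ℤ) (x a b c : Fin n → Bool) :
    ∑ ε : Fin 3 → Bool, F (fun j => x j ^^ decide (Odd #(univ.filter fun i =>
        ε i && (![a, b, c] : Fin 3 → Fin n → Bool) i j))) =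
      F x + F (bxor x a) + F (bxor x b) + F (bxor (bxor x b) a) + F (bxor x c) + F (bxor (bxor x c) a) +
        F (bxor (bxor x c) b) + F (bxor (bxor (bxor x c) b) a) := by
  have e : (![a, b, c] : Fin 3 → Fin n → Bool) =
      (Fin.cons a (Fin.cons b (Fin.cons c (fun i : Fin 0 => i.elim0) : Fin 1 → Fin n → Bool) : Fin 2 → Fin n → Bool)
        : Fin 3 → Fin n → Bool) := rfl
  rw [e]
  simp only [tep_sum_split, Fintype.sum_unique, fr_pt3, Bool.true_and, Bool.false_and, es_bxor_false,
    show (fun j => a j) = a from rfl, show (fun j => b j) = b from rfl, show (fun j => c j) = c from rfl]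
  ring

/-- **The parametrised 4-flat sum, written out** (sixteen terms, later directions innermost). [folklore] -/
theorem fr_sum4 (F : (Fin n → Bool) → ℤ) (x a₀ a₁ a₂ a₃ : Fin n → Bool) :
    ∑ ε : Fin 4 → Bool, F (fun j => x j ^^ decide (Odd #(univ.filter fun i =>
        ε i && (![a₀, a₁, a₂, a₃] : Fin 4 → Fin n → Bool) i j))) =
      F x + F (bxor x a₀) + F (bxor x a₁) + F (bxor (bxor x a₁) a₀) +
      F (bxor x a₂) + F (bxor (bxor x a₂) a₀) + F (bxor (bxor x a₂) a₁) + F (bxor (bxor (bxor x a₂) a₁) a₀) +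
      F (bxor x a₃) + F (bxor (bxor x a₃) a₀) + F (bxor (bxor x a₃) a₁) + F (bxor (bxor (bxor x a₃) a₁) a₀) +
      F (bxor (bxor x a₃) a₂) + F (bxor (bxor (bxor x a₃) a₂) a₀) + F (bxor (bxor (bxor x a₃) a₂) a₁) +
      F (bxor (bxor (bxor (bxor x a₃) a₂) a₁) a₀) := by
  have e : (![a₀, a₁, a₂, a₃] : Fin 4 → Fin n → Bool) =
      (Fin.cons a₀ (Fin.cons a₁ (Fin.cons a₂ (Fin.cons a₃ (fun i : Fin 0 => i.elim0) : Fin 1 → Fin n → Bool)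
        : Fin 2 → Fin n → Bool) : Fin 3 → Fin n → Bool) : Fin 4 → Fin n → Bool) := rfl
  rw [e]
  simp only [tep_sum_split, Fintype.sum_unique, fl_pt_four, Bool.true_and, Bool.false_and, es_bxor_false,
    show (fun j => a₀ j) = a₀ from rfl, show (fun j => a₁ j) = a₁ from rfl, show (fun j => a₂ j) = a₂ from rfl,
    show (fun j => a₃ j) = a₃ from rfl]
  ring

/-! ### Membership of flat points in a coset -/

/-- The explicit-xor form of a parametrised 3-flat point. [folklore] -/
theorem fr_flatPt_three (b : Fin n → Bool) (a : Fin 3 → Fin n → Bool) (ε : Fin 3 → Bool) :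
    (fun j => b j ^^ decide (Odd #(univ.filter fun i => ε i && a i j))) =
      bxor (bxor (bxor b (fun j => ε 0 && a 0 j)) (fun j => ε 1 && a 1 j)) (fun j => ε 2 && a 2 j) := by
  funext j
  rw [card_filter, Fin.sum_univ_three]
  show (b j ^^ decide (Odd ((if (ε 0 && a 0 j) = true then 1 else 0) + (if (ε 1 && a 1 j) = true then 1 else 0) +
    (if (ε 2 && a 2 j) = true then 1 else 0)))) = (((b j ^^ (ε 0 && a 0 j)) ^^ (ε 1 && a 1 j)) ^^ (ε 2 && a 2 j))
  cases (ε 0 && a 0 j) <;> cases (ε 1 && a 1 j) <;> cases (ε 2 && a 2 j) <;> cases b j <;> decide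

/-- A scaled direction `ε·a` (`a ∈ V₀`, `0 ∈ V₀`) lies in `V₀`. [folklore] -/
theorem fr_smul_mem (V₀ : Finset (Fin n → Bool)) (h0 : zeroVec ∈ V₀) {a : Fin n → Bool} (ha : a ∈ V₀) (e : Bool) :
    (fun j => e && a j) ∈ V₀ := by
  cases e
  · simp only [Bool.false_and]; exact h0
  · simp only [Bool.true_and]; exact ha

/-- Flat points with base in `S` and three directions in `V₀` stay in `S` (`S` stable under `⊕ V₀`). [folklore] -/
theorem fr_mem_flatPt3 (V₀ : Finset (Fin n → Bool)) (h0 : zeroVec ∈ V₀) (P : (Fin n → Bool) → Prop)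
    (hPV : ∀ x, P x → ∀ a ∈ V₀, P (bxor x a)) {x : Fin n → Bool} (hx : P x) (a : Fin 3 → Fin n → Bool)
    (ha : ∀ i, a i ∈ V₀) (ε : Fin 3 → Bool) :
    P (fun j => x j ^^ decide (Odd #(univ.filter fun i => ε i && a i j))) := by
  rw [fr_flatPt_three]
  exact hPV _ (hPV _ (hPV _ hx _ (fr_smul_mem V₀ h0 (ha 0) _)) _ (fr_smul_mem V₀ h0 (ha 1) _)) _
    (fr_smul_mem V₀ h0 (ha 2) _)

/-- Flat points with base in `S` and four directions in `V₀` stay in `S`. [folklore] -/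
theorem fr_mem_flatPt4 (V₀ : Finset (Fin n → Bool)) (h0 : zeroVec ∈ V₀) (P : (Fin n → Bool) → Prop)
    (hPV : ∀ x, P x → ∀ a ∈ V₀, P (bxor x a)) {x : Fin n → Bool} (hx : P x) (a : Fin 4 → Fin n → Bool)
    (ha : ∀ i, a i ∈ V₀) (ε : Fin 4 → Bool) :
    P (fun j => x j ^^ decide (Odd #(univ.filter fun i => ε i && a i j))) := by
  rw [es_flatPt_four, es_flatPt_bxor]
  exact hPV _ (hPV _ (hPV _ (hPV _ hx _ (fr_smul_mem V₀ h0 (ha 0) _)) _ (fr_smul_mem V₀ h0 (ha 1) _)) _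
    (fr_smul_mem V₀ h0 (ha 2) _)) _ (fr_smul_mem V₀ h0 (ha 3) _)

/-! ### From `3`-flat sign sums `≡ 0 (mod 4)` to constant second differences along the coset -/

/-- Eight signs summing to `0 mod 4` have an even number of `−1`s. [folklore] -/
theorem fr_xor8_of_dvd {b₀ b₁ b₂ b₃ b₄ b₅ b₆ b₇ : Bool}
    (h : (4 : ℤ) ∣ sZ b₀ + sZ b₁ + sZ b₂ + sZ b₃ + sZ b₄ + sZ b₅ + sZ b₆ + sZ b₇) :
    (b₀ ^^ b₁ ^^ b₂ ^^ b₃ ^^ b₄ ^^ b₅ ^^ b₆ ^^ b₇) = false := by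
  revert h
  revert b₀ b₁ b₂ b₃ b₄ b₅ b₆ b₇
  decide

/-- **Second differences along the coset are base-point free** ("`h` is quadratic along `S`").  Hypotheses: `S = {P}` is the
`V₀`-coset through `x₀` (`P x → x₀ ⊕ x ∈ V₀`), and every parametrised 3-flat sign sum with base in `S` and directions in `V₀` is
`≡ 0 (mod 4)`.  Conclusion: `h(x ⊕ p ⊕ q) = h(x) ⊕ h(x⊕p) ⊕ h(x⊕q) ⊕ B(p,q)` for `x ∈ S`, `p, q ∈ V₀`, with
`B(p,q) = h(x₀) ⊕ h(x₀⊕p) ⊕ h(x₀⊕q) ⊕ h(x₀⊕p⊕q)`. [cite: Carlet2020, §5.2] -/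
theorem fr_hsd (V₀ : Finset (Fin n → Bool)) (P : (Fin n → Bool) → Prop) (x₀ : Fin n → Bool) (hx₀ : P x₀)
    (hVP : ∀ x, P x → bxor x₀ x ∈ V₀) (h : (Fin n → Bool) → Bool)
    (H3 : ∀ x, P x → ∀ a b c : Fin n → Bool, a ∈ V₀ → b ∈ V₀ → c ∈ V₀ →
      (4 : ℤ) ∣ ∑ ε : Fin 3 → Bool, sZ (h (fun j => x j ^^ decide (Odd #(univ.filter fun i =>
        ε i && (![a, b, c] : Fin 3 → Fin n → Bool) i j))))) :
    ∀ x, P x → ∀ p ∈ V₀, ∀ q ∈ V₀, h (bxor (bxor x p) q) =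
      (h x ^^ h (bxor x p) ^^ h (bxor x q) ^^ (h x₀ ^^ h (bxor x₀ p) ^^ h (bxor x₀ q) ^^ h (bxor (bxor x₀ p) q))) := by
  intro x hx p hp q hq
  have H := H3 x₀ hx₀ q p (bxor x₀ x) hq hp (hVP x hx)
  have e3 := fr_sum3 (fun y => sZ (h y)) x₀ q p (bxor x₀ x)
  beta_reduce at e3
  rw [e3] at H
  simp only [bxor_bxor_cancel_left] at H
  have X := fr_xor8_of_dvd H
  revert X
  generalize h x₀ = A₀
  generalize h (bxor x₀ q) = A₁
  generalize h (bxor x₀ p) = A₂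
  generalize h (bxor (bxor x₀ p) q) = A₃
  generalize h x = A₄
  generalize h (bxor x q) = A₅
  generalize h (bxor x p) = A₆
  generalize h (bxor (bxor x p) q) = A₇
  revert A₀ A₁ A₂ A₃ A₄ A₅ A₆ A₇
  decide

/-! ### The relative alternating form `B(p,q) = h(x₀) ⊕ h(x₀⊕p) ⊕ h(x₀⊕q) ⊕ h(x₀⊕p⊕q)` -/

section BForm

variable (V₀ : Finset (Fin n → Bool)) (P : (Fin n → Bool) → Prop) (x₀ : Fin n → Bool) (h : (Fin n → Bool) → Bool)

/-- `B(p,q) = B(q,p)`. [folklore] -/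
theorem fr_B_symm (p q : Fin n → Bool) :
    (h x₀ ^^ h (bxor x₀ p) ^^ h (bxor x₀ q) ^^ h (bxor (bxor x₀ p) q)) =
      (h x₀ ^^ h (bxor x₀ q) ^^ h (bxor x₀ p) ^^ h (bxor (bxor x₀ q) p)) := by
  rw [dv_bxor_right_comm x₀ p q]
  cases h x₀ <;> cases h (bxor x₀ p) <;> cases h (bxor x₀ q) <;> cases h (bxor (bxor x₀ q) p) <;> rfl

/-- `B(p,p) = 0`. [folklore] -/
theorem fr_B_self (p : Fin n → Bool) :
    (h x₀ ^^ h (bxor x₀ p) ^^ h (bxor x₀ p) ^^ h (bxor (bxor x₀ p) p)) = false := by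
  rw [iw_bxor_assoc, bxor_self, bxor_zeroVec]
  cases h x₀ <;> cases h (bxor x₀ p) <;> rfl

/-- **Bi-additivity along `V₀`**: `B(a ⊕ a', b) = B(a,b) ⊕ B(a',b)` for `a, a', b ∈ V₀`, given base-free second differences on the coset.
[cite: Carlet2020, §5.2] -/
theorem fr_B_add_left (hx₀ : P x₀) (hPV : ∀ x, P x → ∀ a ∈ V₀, P (bxor x a))
    (hsd : ∀ x, P x → ∀ p ∈ V₀, ∀ q ∈ V₀, h (bxor (bxor x p) q) =
      (h x ^^ h (bxor x p) ^^ h (bxor x q) ^^ (h x₀ ^^ h (bxor x₀ p) ^^ h (bxor x₀ q) ^^ h (bxor (bxor x₀ p) q))))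
    {a a' b : Fin n → Bool} (ha : a ∈ V₀) (ha' : a' ∈ V₀) (hb : b ∈ V₀) :
    (h x₀ ^^ h (bxor x₀ (bxor a a')) ^^ h (bxor x₀ b) ^^ h (bxor (bxor x₀ (bxor a a')) b)) =
      ((h x₀ ^^ h (bxor x₀ a) ^^ h (bxor x₀ b) ^^ h (bxor (bxor x₀ a) b)) ^^
        (h x₀ ^^ h (bxor x₀ a') ^^ h (bxor x₀ b) ^^ h (bxor (bxor x₀ a') b))) := by
  rw [show bxor x₀ (bxor a a') = bxor (bxor x₀ a) a' from (iw_bxor_assoc _ _ _).symm]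
  rw [hsd (bxor x₀ a) (hPV _ hx₀ _ ha) a' ha' b hb]
  generalize h x₀ = A₀
  generalize h (bxor x₀ a) = A₁
  generalize h (bxor x₀ a') = A₂
  generalize h (bxor x₀ b) = A₃
  generalize h (bxor (bxor x₀ a) a') = A₄
  generalize h (bxor (bxor x₀ a) b) = A₅
  generalize h (bxor (bxor x₀ a') b) = A₆
  revert A₀ A₁ A₂ A₃ A₄ A₅ A₆
  decide

/-- **Symplectic Gram–Schmidt inside `V₀`.** For a hyperbolic pair `p, p' ∈ V₀` (`B(p,p') = 1`) and `b ∈ V₀` there is `b' ∈ V₀`,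
`B`-orthogonal to `p` and `p'`, with the same `B`-pairings as `b` against every `z ∈ V₀` orthogonal to `p, p'`.
[cite: MacWilliamsSloane1977, Ch. 15 §2] -/
theorem fr_gs (hx₀ : P x₀) (hPV : ∀ x, P x → ∀ a ∈ V₀, P (bxor x a)) (hadd : ∀ a ∈ V₀, ∀ b ∈ V₀, bxor a b ∈ V₀)
    (hsd : ∀ x, P x → ∀ p ∈ V₀, ∀ q ∈ V₀, h (bxor (bxor x p) q) =
      (h x ^^ h (bxor x p) ^^ h (bxor x q) ^^ (h x₀ ^^ h (bxor x₀ p) ^^ h (bxor x₀ q) ^^ h (bxor (bxor x₀ p) q))))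
    {p p' b : Fin n → Bool} (hp : p ∈ V₀) (hp' : p' ∈ V₀) (hb : b ∈ V₀)
    (hpp : (h x₀ ^^ h (bxor x₀ p) ^^ h (bxor x₀ p') ^^ h (bxor (bxor x₀ p) p')) = true) :
    ∃ b' ∈ V₀, (h x₀ ^^ h (bxor x₀ b') ^^ h (bxor x₀ p) ^^ h (bxor (bxor x₀ b') p)) = false ∧
      (h x₀ ^^ h (bxor x₀ b') ^^ h (bxor x₀ p') ^^ h (bxor (bxor x₀ b') p')) = false ∧
      ∀ z ∈ V₀, (h x₀ ^^ h (bxor x₀ z) ^^ h (bxor x₀ p) ^^ h (bxor (bxor x₀ z) p)) = false →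
        (h x₀ ^^ h (bxor x₀ z) ^^ h (bxor x₀ p') ^^ h (bxor (bxor x₀ z) p')) = false →
        (h x₀ ^^ h (bxor x₀ b') ^^ h (bxor x₀ z) ^^ h (bxor (bxor x₀ b') z)) =
          (h x₀ ^^ h (bxor x₀ b) ^^ h (bxor x₀ z) ^^ h (bxor (bxor x₀ b) z)) := by
  have hsymm := fr_B_symm x₀ h
  have hBadd : ∀ {a a' c : Fin n → Bool}, a ∈ V₀ → a' ∈ V₀ → c ∈ V₀ →
      (h x₀ ^^ h (bxor x₀ (bxor a a')) ^^ h (bxor x₀ c) ^^ h (bxor (bxor x₀ (bxor a a')) c)) =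
        ((h x₀ ^^ h (bxor x₀ a) ^^ h (bxor x₀ c) ^^ h (bxor (bxor x₀ a) c)) ^^
          (h x₀ ^^ h (bxor x₀ a') ^^ h (bxor x₀ c) ^^ h (bxor (bxor x₀ a') c))) :=
    fun ha ha' hc => fr_B_add_left V₀ P x₀ h hx₀ hPV hsd ha ha' hc
  have hpp' : (h x₀ ^^ h (bxor x₀ p') ^^ h (bxor x₀ p) ^^ h (bxor (bxor x₀ p') p)) = true := by rw [hsymm]; exact hpp
  have h00 := fr_B_self x₀ h p
  have h11 := fr_B_self x₀ h p'
  cases hβ : (h x₀ ^^ h (bxor x₀ b) ^^ h (bxor x₀ p) ^^ h (bxor (bxor x₀ b) p)) <;>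
    cases hβ' : (h x₀ ^^ h (bxor x₀ b) ^^ h (bxor x₀ p') ^^ h (bxor (bxor x₀ b) p'))
  · exact ⟨b, hb, hβ, hβ', fun z _ _ _ => rfl⟩
  · -- B(b,p') = 1: correct by p
    refine ⟨bxor b p, hadd _ hb _ hp, ?_, ?_, fun z hz hz0 _ => ?_⟩
    · rw [hBadd hb hp hp, hβ, h00]; decide
    · rw [hBadd hb hp hp', hβ', hpp]; decide
    · rw [hBadd hb hp hz, show (h x₀ ^^ h (bxor x₀ p) ^^ h (bxor x₀ z) ^^ h (bxor (bxor x₀ p) z)) = false by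
        rw [hsymm]; exact hz0, Bool.xor_false]
  · -- B(b,p) = 1: correct by p'
    refine ⟨bxor b p', hadd _ hb _ hp', ?_, ?_, fun z hz _ hz1 => ?_⟩
    · rw [hBadd hb hp' hp, hβ, hpp']; decide
    · rw [hBadd hb hp' hp', hβ', h11]; decide
    · rw [hBadd hb hp' hz, show (h x₀ ^^ h (bxor x₀ p') ^^ h (bxor x₀ z) ^^ h (bxor (bxor x₀ p') z)) = false by
        rw [hsymm]; exact hz1, Bool.xor_false]
  · -- both: correct by p and p'
    refine ⟨bxor (bxor b p) p', hadd _ (hadd _ hb _ hp) _ hp', ?_, ?_, fun z hz hz0 hz1 => ?_⟩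
    · rw [hBadd (hadd _ hb _ hp) hp' hp, hBadd hb hp hp, hβ, h00, hpp']; decide
    · rw [hBadd (hadd _ hb _ hp) hp' hp', hBadd hb hp hp', hβ', hpp, h11]; decide
    · rw [hBadd (hadd _ hb _ hp) hp' hz, hBadd hb hp hz,
        show (h x₀ ^^ h (bxor x₀ p) ^^ h (bxor x₀ z) ^^ h (bxor (bxor x₀ p) z)) = false by rw [hsymm]; exact hz0,
        show (h x₀ ^^ h (bxor x₀ p') ^^ h (bxor x₀ z) ^^ h (bxor (bxor x₀ p') z)) = false by rw [hsymm]; exact hz1,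
        Bool.xor_false, Bool.xor_false]

end BForm

/-! ### Pigeonhole inside `V₀` -/

/-- **A difference outside a small set, inside `V₀`.** If `|C|·#R < #V₀` for the value type `C` of a labelling `φ`, then two points of
`V₀` with the same label differ by a vector (of `V₀`) outside `R`. [folklore] -/
theorem fr_diff_outside {γ : Type*} [Fintype γ] [DecidableEq γ] (V₀ R : Finset (Fin n → Bool)) (φ : (Fin n → Bool) → γ)
    (hcard : Fintype.card γ * #R < #V₀) :
    ∃ x ∈ V₀, ∃ x' ∈ V₀, φ x = φ x' ∧ bxor x x' ∉ R := by
  classical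
  obtain ⟨c, -, hc⟩ := exists_lt_card_fiber_of_mul_lt_card_of_maps_to (s := V₀) (t := (univ : Finset γ))
    (f := φ) (fun a _ => mem_univ _) (by rw [card_univ]; exact hcard)
  obtain ⟨x, hx⟩ : (V₀.filter fun x => φ x = c).Nonempty := by rw [← card_pos]; omega
  have himg : #R < #((V₀.filter fun x' => φ x' = c).image (bxor x)) := by
    rw [card_image_of_injective _ fun a b hab => by simpa only [bxor_bxor_cancel_left] using congrArg (bxor x) hab]
    exact hc
  obtain ⟨t, ht, htR⟩ := exists_mem_notMem_of_card_lt_card himg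
  obtain ⟨x', hx', rfl⟩ := mem_image.1 ht
  exact ⟨x, (mem_filter.1 hx).1, x', (mem_filter.1 hx').1, (mem_filter.1 hx).2.trans (mem_filter.1 hx').2.symm, htR⟩

end Summit.QuantumAdvantage.QuantumAdvantage.Theorems.CubicForrelation.NearExactIsExact

end
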